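import Summits.Langlands.Langlands.Theses.QuarterDeficit1951

/-!
# Sketch for crux idea `bsv-quasimode-sighting` (negation lens) on `CensusDeficit1951`

Two first lemmas, stated over existing declarations:

* `not_censusDeficit1951_of_fingerprinted_form` — the typed OBSTRUCTION (proved here): one fingerprinted
  window cusp form on `(Γ₀(1951), χ)` for one order-5 `χ` refutes the crux (contrapositive of the
  format's decoding theorem `MaassHeckeTraceCensus.not_fingerprinted`). This is what a certified
  sighting — by trace formula OR by the BSV quasimode certificate — plugs into.
* `jointConcentration` — the finite-dimensional core of BSV06 Lemma 3.2 ((3.11)–(3.12)): a vector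
  whose joint defect `Σ_k ‖T_k f − a_k f‖²` is `≤ H‖f‖²` against a joint orthonormal eigenbasis has an
  eigenline with `Σ_k |ev_k − a_k|² ≤ H` (signature only).
-/

namespace Summit.Langlands.Langlands.Cruxes.CensusDeficit1951.BsvQuasimodeSighting

open Literature.NumberTheory.Automorphic
open scoped ComplexConjugate

/-- **Typed obstruction / first stub of the negation line.** A non-zero weight-0 Maass cusp form on
`(Γ₀(1951), χ)`, `χ` of order 5, with `|λ − 1/4| ≤ 1/100`, joint `T_p`-eigenfunction for `p ≤ 13` with
fingerprint quantities within `1/100` of `Φ`, refutes `CensusDeficit1951` (by decoding theorem I on the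
purported deficit transcript for that `χ`). [folklore] -/
theorem not_censusDeficit1951_of_fingerprinted_form
    (χ : DirichletCharacter ℂ 1951) (hχ : orderOf χ = 5) (u : UpperHalfPlane → ℂ) (lam : ℝ) (μ : ℕ → ℂ)
    (hu : IsMaassCuspFormOn 1951 χ u lam) (hne : ∃ z, u z ≠ 0) (hwin : |lam - 1 / 4| ≤ 1 / 100)
    (hT : ∀ p ∈ ({2, 3, 5, 7, 11, 13} : Finset ℕ), maassHeckeOp 1951 χ p u = μ p • u)
    (hfp : ∀ p ∈ ({2, 3, 5, 7, 11, 13} : Finset ℕ), ∃ φ ∈ icosahedralFingerprint,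
      ‖μ p ^ 2 * conj (χ (p : ZMod 1951)) - φ‖ ≤ 1 / 100) :
    ¬ Summit.Langlands.Langlands.Theses.QuarterDeficit1951.CensusDeficit1951 := by
  intro hC
  obtain ⟨c, hw, ht, hp, hc, hv⟩ := hC χ hχ
  have hw' : ((1 / 100 : ℚ) : ℝ) ≤ (c.window : ℝ) := by exact_mod_cast hw
  have hwin' : |lam - 1 / 4| ≤ (c.window : ℝ) := hwin.trans (by push_cast at hw'; exact hw')
  obtain ⟨p, hpc, hfar⟩ :=
    MaassHeckeTraceCensus.not_fingerprinted hc hv hu hne hwin' (fun p hpp => hT p (hp p hpp))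
  obtain ⟨φ, hφ, hclose⟩ := hfp p (hp p hpc)
  have h1 := hfar φ hφ
  have h2 : ((1 / 100 : ℚ) : ℝ) ≤ (c.fpTol : ℝ) := by exact_mod_cast ht
  push_cast at h2
  linarith

/-- **Joint concentration (BSV06 Lemma 3.2, finite-dimensional core; signature only).** In a
finite-dimensional complex inner product space with an orthonormal basis of joint eigenvectors of
linear maps `T k`, a non-zero `f` with `Σ_{k ∈ S} ‖T_k f − a_k f‖² ≤ H ‖f‖²` forces an eigenline `i`
with `Σ_{k ∈ S} |ev i k − a k|² ≤ H`. [cite: BookerStrombergssonVenkatesh2006, Lemma 3.2] -/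
theorem jointConcentration
    {E : Type*} [NormedAddCommGroup E] [InnerProductSpace ℂ E] [FiniteDimensional ℂ E]
    {ι : Type*} [Fintype ι] (b : OrthonormalBasis ι ℂ E)
    {κ : Type*} (S : Finset κ) (T : κ → E →ₗ[ℂ] E) (ev : ι → κ → ℂ)
    (hT : ∀ i k, T k (b i) = ev i k • b i)
    (f : E) (hf : f ≠ 0) (a : κ → ℂ) (H : ℝ)
    (hdef : ∑ k ∈ S, ‖T k f - a k • f‖ ^ 2 ≤ H * ‖f‖ ^ 2) :
    ∃ i, ∑ k ∈ S, ‖ev i k - a k‖ ^ 2 ≤ H := by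
  sorry

end Summit.Langlands.Langlands.Cruxes.CensusDeficit1951.BsvQuasimodeSighting
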